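import Literature.NumberTheory.EllipticCurves.PAdicLFunctionIntegralityProofs
import Literature.NumberTheory.EllipticCurves.ModPReducibilityProofs
import HarnessLib

/-!
# Stein–Wuthrich 2013, Lemma 3.6, quantitative form: the denominator of the modular symbols
# `[u/pⁿ]⁺` entering `L_p(E, T)` divides `4 · #Ẽ(𝔽_ℓ)` for every good prime `ℓ`

HONEST FRAMING (cell `b2b-bsdr2sha`, run/shared/lean/b2b/bsd-rank2-sha/; LIT2 seat): a
certification cell for per-pair statements `#Ш(E/ℚ)[p^∞] = p^k` from PRINTED theorems (Kato,
Skinner–Urban, Schneider/Perrin-Riou) plus certified `p`-adic computations; no summit claim. This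
file contains THEOREMS ONLY (no definition, no named fact): it packages, for the rows and for the
census's rational-reconstruction certificate («L-S4», referee R-012), a per-curve denominator bound
for the modular symbols that is already implicit in the tree's integrality files.

## The printed statement and what is proved here

Stein–Wuthrich, Math. Comp. 82 (2013), §3 (authors' manuscript p. 6 L16–38): for `r ∈ ℚ`,
`λ⁺(r) = −πi(∫_r^{i∞} f + ∫_{−r}^{i∞} f) ∈ ℝ`, "By a theorem of Manin [Man72], we know that
`λ⁺(r)` belongs to `ℚ·Ω_E`. For all `r ∈ ℚ`, the modular symbol `[r]⁺ ∈ ℚ` is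
`[r]⁺ = λ⁺(r)/Ω_E`"; the measure `µ_α` (ms p. 6 L48–67) uses only the symbols `[a/p^k]⁺`; and
**Lemma 3.6** (ms p. 9 L12–21): "The `c_k` are uniformly bounded above. *Proof.* … the lemma is
equivalent to showing that the modular symbol `[x]⁺` appearing in the definition of `µ_α` has
bounded denominator. By the Abel-Jacobi theorem … a bound on the denominator of `[x]⁺` is the
largest power of `p` that divides the exponent of the image of `C` [the cuspidal subgroup] in
`E(Q̄)`. The claim follows since `C` is finite … and `C` is torsion as noted on the footnote of
[Man72, pg. 35]." Here `c_n = max(0, −min_j ord_p(a_{n,j}))` (ms p. 8 L59–60).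

In the tree's vocabulary (`Literature.NumberTheory.EllipticCurves.ModularSymbols`,
`….PAdicLFunction`): `plusSymbol f r = ({∞,r}_f + {∞,−r}_f)/2 = λ⁺(r)`, `Ω⁺_f = plusPeriod f`
(`re Λ_f = ℤ·Ω⁺_f/2`), `[r]⁺_f = ratPlusSymbol f r = re(plusSymbol f r)/Ω⁺_f ∈ ℚ`; for the
`X₀(N)`-optimal curve with Manin constant `1` one has `Λ_E = Λ_f`, `Ω_E = Ω⁺_f` and
`[r]⁺ = [r]⁺_f` (Agashe–Ribet–Stein 2006, §2 and Thm. 2.6; lit/LIT2-H4-LS4-AS-PRINTED.md §3).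

PROVED here, for the newform `f` of `E = W/ℚ` (`IsNewformOf W f`), a prime `ℓ` of good reduction
and any `x ∈ ℚ` whose denominator is prime to the level `N` (in particular `x = u/pⁿ` for a good
prime `p`):

* `exists_ratPlusSymbol_eq_div_reductionPointCount`: `[x]⁺_f = k / (4 · #Ẽ(𝔽_ℓ))` for some
  `k ∈ ℤ` — the quantitative content of Lemma 3.6's proof at cusps equivalent to `0`: the
  Eisenstein/Hecke relation `(a_ℓ − ℓ − 1){∞,0}_f ∈ Λ_f` for EVERY prime `ℓ ∤ N` (tree theorem
  `sub_mul_modularSymbol_zero_mem_periodLattice`; Manin 1972 Thm. 3.3, Cremona 1997 (2.8.8),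
  Mazur–Tate–Teitelbaum 1986 (4.2)), `a_ℓ(f) = a_ℓ(E) = ℓ + 1 − #Ẽ(𝔽_ℓ)`
  (`cuspCoeff_eq_frobeniusTrace_of_isNewformOf_holds`, `WeierstrassCurve.frobeniusTrace`), the
  relation `{∞,x}_f − {∞,0}_f ∈ Λ_f` for `gcd(den x, N) = 1` and `re Λ_f = ℤ·Ω⁺_f/2`
  (`exists_ratPlusSymbol_eq_div`);
* `den_ratPlusSymbol_dvd_reductionPointCount`: hence `den [x]⁺_f ∣ 4 · #Ẽ(𝔽_ℓ)`, and over two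
  good primes `den [x]⁺_f ∣ 4 · gcd(#Ẽ(𝔽_ℓ₁), #Ẽ(𝔽_ℓ₂))` (`den_ratPlusSymbol_dvd_gcd`);
* `den_ratPlusSymbol_div_pow_dvd`: the case `x = u/pⁿ`, `p` a good prime (the symbols of `µ_α`);
* `norm_ratPlusSymbol_div_pow_le_one`: `‖[u/pⁿ]⁺_f‖_p ≤ 1` for `p` odd and good with `E[p]`
  irreducible — the Literature-level form of the rows' integrality binder
  (`IsNewformOf.norm_ratPlusSymbol_le_one`; Greenberg–Vatsal 2000 Prop. 3.7 = SW13 Prop. 3.7).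

Example (census row 0, `446d1`, `p = 5`): `#Ẽ(𝔽_3) = 7`, `#Ẽ(𝔽_5) = 10`, so every `[u/5ⁿ]⁺`
lies in `¼ℤ`. Nothing here uses the modular parametrisation, `J₀(N)`, the Manin constant or the
torsion of `E(ℚ^ab)`; the comparison `[r]⁺ = [r]⁺_f` (optimality, `c_E = 1`) is where those enter
and is NOT asserted in this file.

## References

* [SteinWuthrich2013] W. Stein, C. Wuthrich, *Algorithms for the arithmetic of elliptic curves
  using Iwasawa theory*, Math. Comp. 82 (2013) 1757–1792, §3 and Lemma 3.6 (ms pp. 6, 8–9).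
* [Manin1972] Ju. I. Manin, *Parabolic points and zeta functions of modular curves*, Izv. 36
  (1972), Thm. 3.3, Cor. 3.6 and footnote p. 35 (Drinfeld).
* [CremonaAlgorithms1997] J. E. Cremona, *Algorithms for modular elliptic curves*, 2nd ed., §2.8
  (2.8.8).
* [MazurTateTeitelbaum1986Invent] B. Mazur, J. Tate, J. Teitelbaum, Invent. Math. 84 (1986),
  §I.4 (4.2), §I.10.
* Cell files: lit/LIT2-H4-LS4-AS-PRINTED.md §3, §4, §7 (Route B); referee/REFEREE.md R-012, R-013.
-/

noncomputable section

open scoped MatrixGroups ModularForm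

open CongruenceSubgroup Literature.NumberTheory.EllipticCurves.ModularForms

namespace Literature.NumberTheory.EllipticCurves.SteinWuthrich2013

variable {N : ℕ} [NeZero N] {f : CuspForm (Gamma0 N) 2} {W : WeierstrassCurve ℚ} [W.IsElliptic]
  [W.IsGloballyMinimal]

/-- **Stein–Wuthrich 2013, Lemma 3.6 (quantitative, at cusps prime to the level).** For the newform
`f` of `E = W/ℚ`, a prime `ℓ` of good reduction and `x ∈ ℚ` with `gcd(den x, N) = 1`:
`[x]⁺_f = k / (4 · #Ẽ(𝔽_ℓ))` for some integer `k` (the Eisenstein multiple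
`(a_ℓ − ℓ − 1){∞,0}_f = −#Ẽ(𝔽_ℓ)·{∞,0}_f ∈ Λ_f`, `{∞,x}_f ≡ {∞,0}_f (mod Λ_f)`, `re Λ_f = ℤ·Ω⁺_f/2`).
[cite: SteinWuthrich2013, Lemma 3.6 (ms p. 9 L12–21)] -/
theorem exists_ratPlusSymbol_eq_div_reductionPointCount (hf : IsNewformOf W f) {ℓ : ℕ}
    [Fact ℓ.Prime] (hgood : W.HasGoodReductionAtPrime ℓ) {x : ℚ} (hx : Nat.Coprime x.den N) :
    ∃ k : ℤ, ratPlusSymbol f x = (k : ℚ) / (4 * (W.reductionPointCount ℓ : ℚ)) := by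
  have hℓ : ℓ.Prime := Fact.out
  have hℓN : ¬ ℓ ∣ N := not_dvd_level_of_isNewformOf hf hgood
  have h0 := sub_mul_modularSymbol_zero_mem_periodLattice hf.1 hℓ hℓN
  rw [cuspCoeff_eq_frobeniusTrace_of_isNewformOf_holds hf hgood] at h0
  have hcast : ((W.frobeniusTrace ℓ : ℤ) : ℂ) - ℓ - 1 = ((-(W.reductionPointCount ℓ : ℤ) : ℤ) : ℂ) := by
    simp only [WeierstrassCurve.frobeniusTrace]
    push_cast
    ring
  rw [hcast] at h0
  have hn₀ : (-(W.reductionPointCount ℓ : ℤ) : ℤ) ≠ 0 := by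
    haveI : NeZero ℓ := ⟨hℓ.ne_zero⟩
    have := W.reductionPointCount_pos ℓ
    omega
  obtain ⟨k, hk⟩ := exists_ratPlusSymbol_eq_div f hn₀ h0 hx
  refine ⟨-k, ?_⟩
  rw [hk]
  push_cast
  have hn : (W.reductionPointCount ℓ : ℚ) ≠ 0 := by
    haveI : NeZero ℓ := ⟨hℓ.ne_zero⟩
    exact_mod_cast (W.reductionPointCount_pos ℓ).ne'
  field_simp

/-- **Denominator bound.** Under the same hypotheses `den [x]⁺_f ∣ 4 · #Ẽ(𝔽_ℓ)`.
[cite: SteinWuthrich2013, Lemma 3.6 (ms p. 9 L12–21)] -/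
theorem den_ratPlusSymbol_dvd_reductionPointCount (hf : IsNewformOf W f) {ℓ : ℕ} [Fact ℓ.Prime]
    (hgood : W.HasGoodReductionAtPrime ℓ) {x : ℚ} (hx : Nat.Coprime x.den N) :
    (ratPlusSymbol f x).den ∣ 4 * W.reductionPointCount ℓ := by
  obtain ⟨k, hk⟩ := exists_ratPlusSymbol_eq_div_reductionPointCount hf hgood hx
  have hdvd : ((((k : ℚ) / ((4 * W.reductionPointCount ℓ : ℕ) : ℚ)).den : ℕ) : ℤ) ∣
      ((4 * W.reductionPointCount ℓ : ℕ) : ℤ) := by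
    have := Rat.den_dvd k (4 * W.reductionPointCount ℓ : ℕ)
    rwa [Rat.divInt_eq_div] at this
  have h' : ratPlusSymbol f x = (k : ℚ) / ((4 * W.reductionPointCount ℓ : ℕ) : ℚ) := by
    rw [hk]; push_cast; rfl
  rw [h']
  exact Int.natCast_dvd_natCast.mp hdvd

/-- **Denominator bound over two good primes**: `den [x]⁺_f ∣ 4 · gcd(#Ẽ(𝔽_ℓ₁), #Ẽ(𝔽_ℓ₂))` — the
form used by the census certificate (e.g. `446d1`: `gcd(#Ẽ(𝔽_3), #Ẽ(𝔽_5)) = gcd(7, 10) = 1`, so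
`den [x]⁺ ∣ 4`). [cite: SteinWuthrich2013, Lemma 3.6 (ms p. 9 L12–21)] -/
theorem den_ratPlusSymbol_dvd_gcd (hf : IsNewformOf W f) {ℓ₁ ℓ₂ : ℕ} [Fact ℓ₁.Prime]
    [Fact ℓ₂.Prime] (h₁ : W.HasGoodReductionAtPrime ℓ₁) (h₂ : W.HasGoodReductionAtPrime ℓ₂)
    {x : ℚ} (hx : Nat.Coprime x.den N) :
    (ratPlusSymbol f x).den ∣ 4 * Nat.gcd (W.reductionPointCount ℓ₁) (W.reductionPointCount ℓ₂) := by
  rw [← Nat.gcd_mul_left]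
  exact Nat.dvd_gcd (den_ratPlusSymbol_dvd_reductionPointCount hf h₁ hx)
    (den_ratPlusSymbol_dvd_reductionPointCount hf h₂ hx)

/-- The denominator of `u/pⁿ` is prime to the level when `p` is a prime of good reduction
(`p ∤ N`, `not_dvd_level_of_isNewformOf`); private plumbing. [folklore] -/
private theorem coprime_den_div_pow (hf : IsNewformOf W f) {p : ℕ} [Fact p.Prime]
    (hgood : W.HasGoodReductionAtPrime p) (u : ℤ) (n : ℕ) :
    Nat.Coprime ((u : ℚ) / ((p ^ n : ℕ) : ℚ)).den N :=
  coprime_den_of_coprime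
    (Nat.Coprime.pow_left n
      ((Nat.Prime.coprime_iff_not_dvd Fact.out).2 (not_dvd_level_of_isNewformOf hf hgood))) u

/-- **The symbols of `µ_α`**: for good primes `p` and `ℓ`, `den [u/pⁿ]⁺_f ∣ 4 · #Ẽ(𝔽_ℓ)`.
[cite: SteinWuthrich2013, Lemma 3.6 (ms p. 9 L12–21)] -/
theorem den_ratPlusSymbol_div_pow_dvd (hf : IsNewformOf W f) {p : ℕ} [Fact p.Prime]
    (hgoodp : W.HasGoodReductionAtPrime p) {ℓ : ℕ} [Fact ℓ.Prime]
    (hgood : W.HasGoodReductionAtPrime ℓ) (u : ℤ) (n : ℕ) :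
    (ratPlusSymbol f ((u : ℚ) / ((p ^ n : ℕ) : ℚ))).den ∣ 4 * W.reductionPointCount ℓ :=
  den_ratPlusSymbol_dvd_reductionPointCount hf hgood (coprime_den_div_pow hf hgoodp u n)

/-- **Integrality of the symbols of `µ_α`** (SW13 Prop. 3.7 input; Greenberg–Vatsal 2000,
Prop. 3.7): for an odd good prime `p` with `E[p]` irreducible, `‖[u/pⁿ]⁺_f‖_p ≤ 1` — the
Literature-level form of the census rows' symbol-integrality binder (same two-line proof as
`IsNewformOf.norm_ratPlusSymbol_le_one` of `KuriharaNumber.lean`: an Eisenstein multiple prime to `p`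
from irreducibility, `exists_intCast_mul_modularSymbol_zero_mem` with the PROVED
`not_irreducible_of_frobeniusTrace_congr_holds`, then `norm_ratPlusSymbol_le_one`). [cite: SteinWuthrich2013, Prop. 3.7 (ms p. 10 L18–21)] -/
theorem norm_ratPlusSymbol_div_pow_le_one (hf : IsNewformOf W f) {p : ℕ} [Fact p.Prime]
    (hp2 : p ≠ 2) (hgood : W.HasGoodReductionAtPrime p) (hirr : W.HasIrreducibleModPGaloisRep p)
    (u : ℤ) (n : ℕ) :
    ‖((ratPlusSymbol f ((u : ℚ) / ((p ^ n : ℕ) : ℚ)) : ℚ) : ℚ_[p])‖ ≤ 1 := by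
  obtain ⟨n₀, hpn₀, h0⟩ :=
    exists_intCast_mul_modularSymbol_zero_mem not_irreducible_of_frobeniusTrace_congr_holds hf hirr
  exact ModularForms.norm_ratPlusSymbol_le_one f hp2 hpn₀ h0 (coprime_den_div_pow hf hgood u n)

end Literature.NumberTheory.EllipticCurves.SteinWuthrich2013
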